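import Mathlib.GroupTheory.Perm.Fin
import Mathlib.Dynamics.PeriodicPts.Lemmas
import Mathlib.Analysis.SpecialFunctions.Pow.Real
import Literature.Computability.QuantumComplexity.SinkOfVerifiableLine

/-!
# Crux `WhiteBoxWalk.WbwVerifiableLineNoSpeedup` (stmt-QuantumAdvantage-2239), line
`cycle-surgery-adversary` — DEFINITIONS and basic API (lead prover's Defs file)

The objects of the picked line (skeleton `Cruxes/WbwVerifiableLineNoSpeedup/Lines/
cycle-surgery-adversary.lean`), landed first so that the stub files of the line can import them.
§1 the hard instances: `pt S i = S^i(0ᵐ)`, `lineOf`, `permInstance m T S = (S, V)` with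
`V(x,i) = [x = S^i 0]`, `sinkOdd`, the hidden horizon `hid = min T 2^(m-4)` and pinned prefix
`pre = T - hid`, the family `InFamily` ((F1) prefix rows `S i = i+1`, `i < pre`; (F2) the line
`x_0..x_T` is simple; (F3) every point has `S`-period `> hid`), the two-row cycle surgery relation
`IsSurgery m T S S'` (`S' = S * swap (x_k) v`, `pre ≤ k < T`, `v` off the line), the finsets
`famX` / `famY` (even / odd sink), `rel ⊆ famX × famY`, and the proved well-formedness
`rel_wellFormed`; the constants `Lstar = max (N², 4 hid² N)`, `dstar = hid · N / 8`.
§3 counting vocabulary of the degree bound: `OffCycle S v`, `srcPeriod S`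
(`Function.minimalPeriod`), `mergeGood` / `splitGood`. The adversary vocabulary (`leftCount`, …,
`ProductBound`, `RelWellFormed`) is the sibling file `…CycleSurgeryAdversaryDefs.lean`.
Definitions and unfolding lemmas only; no statement of the route is asserted. -/

noncomputable section

set_option linter.dupNamespace false

namespace Summit.QuantumAdvantage.QuantumAdvantage.Theorems.WbwVerifiableLineNoSpeedup.CycleSurgery

open Literature.Computability.Cryptography Literature.Computability.QuantumComplexity

/-! ## §1 The hard instances: prefix-pinned long-cycle permutations, and the surgery relation -/

section Family

variable {m T : ℕ}

/-- The source name `0ᵐ`. -/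
def src (m : ℕ) : Fin (2 ^ m) := ⟨0, Nat.two_pow_pos m⟩

/-- The `i`-th point `x_i = S^i(0)` of the orbit of the source under the permutation `S`. -/
def pt (S : Equiv.Perm (Fin (2 ^ m))) (i : ℕ) : Fin (2 ^ m) := (S ^ i) (src m)

/-- The would-be line `x_0, …, x_T` of `S`. -/
def lineOf (m T : ℕ) (S : Equiv.Perm (Fin (2 ^ m))) (i : Fin (T + 1)) : Fin (2 ^ m) := pt S i.val

/-- The SVL instance of a permutation: S-table `= S`, `V(x, i) = [x = S^i(0)]`. -/
def permInstance (m T : ℕ) (S : Equiv.Perm (Fin (2 ^ m))) : SVLInput m T :=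
  svlInput m T S fun x i => decide (x = lineOf m T S i)

/-- The parity of the sink `x_T = S^T(0)` (the function value of the instance of `S`). -/
def sinkOdd (m T : ℕ) (S : Equiv.Perm (Fin (2 ^ m))) : Bool := decide ((pt S T).val % 2 = 1)

/-- The hidden horizon `hid = min (T, 2^m / 16)`: only the last `hid` steps of the line are
unknown to the solver; surgery happens there. -/
def hid (m T : ℕ) : ℕ := min T (2 ^ (m - 4))

/-- The pinned prefix length `pre = T - hid`: the line starts `0 → 1 → ⋯ → pre`. -/
def pre (m T : ℕ) : ℕ := T - hid m T

/-- The hard family `F(m, T)`: (F1) prefix rows `S(i) = i + 1` for `i < pre` (so `x_i = i` for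
`i ≤ pre`); (F2) the line `x_0, …, x_T` is simple; (F3) every point has `S`-period `> hid`. -/
def InFamily (m T : ℕ) (S : Equiv.Perm (Fin (2 ^ m))) : Prop :=
  (∀ x : Fin (2 ^ m), x.val < pre m T → (S x).val = x.val + 1) ∧
    Function.Injective (lineOf m T S) ∧
      ∀ x : Fin (2 ^ m), ∀ j : ℕ, 0 < j → j ≤ hid m T → (S ^ j) x ≠ x

/-- The cycle surgery relation: `S' = S * swap(x_k, v)` (`S'(x_k) = S(v)`, `S'(v) = S(x_k)`, all
other rows equal) for a hidden cut position `pre ≤ k < T` and a name `v` OFF the line of `S`,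
both permutations in the family. -/
def IsSurgery (m T : ℕ) (S S' : Equiv.Perm (Fin (2 ^ m))) : Prop :=
  InFamily m T S ∧ InFamily m T S' ∧
    ∃ k : ℕ, pre m T ≤ k ∧ k < T ∧ ∃ v : Fin (2 ^ m),
      (∀ i : ℕ, i ≤ T → v ≠ pt S i) ∧ S' = S * Equiv.swap (pt S k) v

open scoped Classical in
/-- `X` = the instances of family members with EVEN sink. -/
def famX (m T : ℕ) : Finset (SVLInput m T) :=
  (Finset.univ.filter fun S : Equiv.Perm (Fin (2 ^ m)) =>
      InFamily m T S ∧ sinkOdd m T S = false).image (permInstance m T)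

open scoped Classical in
/-- `Y` = the instances of family members with ODD sink. -/
def famY (m T : ℕ) : Finset (SVLInput m T) :=
  (Finset.univ.filter fun S : Equiv.Perm (Fin (2 ^ m)) =>
      InFamily m T S ∧ sinkOdd m T S = true).image (permInstance m T)

open scoped Classical in
/-- `R ⊆ X × Y` = the surgery pairs (even sink, odd sink), as pairs of input strings. -/
def rel (m T : ℕ) : Finset (SVLInput m T × SVLInput m T) :=
  (Finset.univ.filter fun SS' : Equiv.Perm (Fin (2 ^ m)) × Equiv.Perm (Fin (2 ^ m)) =>
      IsSurgery m T SS'.1 SS'.2 ∧ sinkOdd m T SS'.1 = false ∧ sinkOdd m T SS'.2 = true).image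
    fun SS' => (permInstance m T SS'.1, permInstance m T SS'.2)

/-! ### Orbit bookkeeping -/

/-- `x_0 = 0ᵐ`. -/
@[simp] theorem pt_zero (S : Equiv.Perm (Fin (2 ^ m))) : pt S 0 = src m := by
  simp [pt]

/-- `x_{i+1} = S x_i`. -/
theorem pt_succ (S : Equiv.Perm (Fin (2 ^ m))) (i : ℕ) : pt S (i + 1) = S (pt S i) := by
  simp [pt, pow_succ', Equiv.Perm.mul_apply]

/-- `x_{i+j} = S^j x_i`. -/
theorem pt_add (S : Equiv.Perm (Fin (2 ^ m))) (i j : ℕ) : pt S (i + j) = (S ^ j) (pt S i) := by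
  rw [pt, add_comm, pow_add, Equiv.Perm.mul_apply]
  rfl

/-- Injectivity of the line, in `ℕ`-indexed form. -/
theorem pt_injOn_of_injective {S : Equiv.Perm (Fin (2 ^ m))}
    (hinj : Function.Injective (lineOf m T S)) {i j : ℕ} (hi : i ≤ T) (hj : j ≤ T)
    (h : pt S i = pt S j) : i = j := by
  have := hinj (show lineOf m T S ⟨i, by omega⟩ = lineOf m T S ⟨j, by omega⟩ from h)
  simpa using this

/-- `hid ≤ T`. -/
theorem hid_le (m T : ℕ) : hid m T ≤ T := min_le_left _ _
/-- `hid ≤ 2^(m-4)`. -/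
theorem hid_le_pow (m T : ℕ) : hid m T ≤ 2 ^ (m - 4) := min_le_right _ _

/-- `pre + hid = T`. -/
theorem pre_add_hid (m T : ℕ) : pre m T + hid m T = T := Nat.sub_add_cancel (hid_le m T)
/-- `pre ≤ T`. -/
theorem pre_le (m T : ℕ) : pre m T ≤ T := Nat.sub_le _ _

/-- `1 ≤ hid` as soon as `1 ≤ T`. -/
theorem one_le_hid {m T : ℕ} (hT : 1 ≤ T) : 1 ≤ hid m T := le_min hT Nat.one_le_two_pow

/-- A cut position `pre ≤ k` leaves at most `hid` steps to the sink: `T - k ≤ hid`. -/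
theorem sub_le_hid_of_pre_le {m T k : ℕ} (hk : pre m T ≤ k) : T - k ≤ hid m T := by
  have := pre_add_hid m T
  omega

/-- The pinned prefix: `x_i = i` for `i ≤ pre`. -/
theorem val_pt_of_le_pre {S : Equiv.Perm (Fin (2 ^ m))} (hS : InFamily m T S) :
    ∀ i : ℕ, i ≤ pre m T → (pt S i).val = i := by
  intro i
  induction i with
  | zero => intro _; simp [pt_zero, src]
  | succ i ih =>
    intro hi
    have h := ih (Nat.le_of_succ_le hi)
    have hlt : (pt S i).val < pre m T := by rw [h]; exact hi
    rw [pt_succ, hS.1 _ hlt, h]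

/-- The surgery `S * swap(a, v)` sends the cut point `a` to `S v`. -/
theorem surgery_apply_cut (S : Equiv.Perm (Fin (2 ^ m))) (a v : Fin (2 ^ m)) :
    (S * Equiv.swap a v) a = S v := by
  simp [Equiv.Perm.mul_apply, Equiv.swap_apply_left]

/-- The surgery `S * swap(a, v)` sends `v` to `S a`. -/
theorem surgery_apply_v (S : Equiv.Perm (Fin (2 ^ m))) (a v : Fin (2 ^ m)) :
    (S * Equiv.swap a v) v = S a := by
  simp [Equiv.Perm.mul_apply, Equiv.swap_apply_right]

/-- … and agrees with `S` on every other row. -/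
theorem surgery_apply_of_ne (S : Equiv.Perm (Fin (2 ^ m))) {a v x : Fin (2 ^ m)} (ha : x ≠ a)
    (hv : x ≠ v) : (S * Equiv.swap a v) x = S x := by
  simp [Equiv.Perm.mul_apply, Equiv.swap_apply_of_ne_of_ne ha hv]

/-- Conversely, a row where `S * swap(a, v)` and `S` differ is `a` or `v`. -/
theorem eq_or_eq_of_surgery_apply_ne (S : Equiv.Perm (Fin (2 ^ m))) {a v x : Fin (2 ^ m)}
    (h : (S * Equiv.swap a v) x ≠ S x) : x = a ∨ x = v := by
  by_contra hx
  push Not at hx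
  exact h (surgery_apply_of_ne S hx.1 hx.2)

/-- The lines of `S` and of a surgery `S * swap(x_k, v)` (`k ≤ T`, `v` off the line) agree up to
position `k`. -/
theorem pt_surgery_of_le {S : Equiv.Perm (Fin (2 ^ m))} (hinj : Function.Injective (lineOf m T S))
    {k : ℕ} (hk : k ≤ T) {v : Fin (2 ^ m)} (hv : ∀ i : ℕ, i ≤ T → v ≠ pt S i) :
    ∀ i : ℕ, i ≤ k → pt (S * Equiv.swap (pt S k) v) i = pt S i := by
  intro i
  induction i with
  | zero => intro _; rw [pt_zero, pt_zero]
  | succ i ih =>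
    intro hi
    have hik : i < k := hi
    rw [pt_succ, pt_succ, ih hik.le]
    apply surgery_apply_of_ne
    · intro h
      have := pt_injOn_of_injective hinj (by omega) hk h
      omega
    · exact (hv i (by omega)).symm

/-! ### Instances of family members -/

/-- A family member's instance has the verifiable line `x_i = S^i(0)`. -/
theorem isSvlLine_permInstance {S : Equiv.Perm (Fin (2 ^ m))} (hS : InFamily m T S) :
    IsSvlLine (permInstance m T S) (lineOf m T S) := by
  rw [permInstance, isSvlLine_iff]
  refine ⟨hS.2.1, ?_, fun i => ?_, fun x i => ?_⟩
  · simp [lineOf, pt_zero, src]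
  · rw [svlSucc_svlInput]
    simp only [lineOf, Fin.val_castSucc, Fin.val_succ, pt_succ]
  · rw [svlVerify_svlInput]

/-- Hence it lies in the promise set. -/
theorem permInstance_mem {S : Equiv.Perm (Fin (2 ^ m))} (hS : InFamily m T S) :
    permInstance m T S ∈ svlPromise m T :=
  ⟨lineOf m T S, isSvlLine_permInstance hS⟩

/-- Family instances are promise instances (`∀`-form of `permInstance_mem`; the registered
sub-goal this definitions file discharges). -/
theorem permInstance_mem_svlPromise : ∀ (m T : ℕ) (S : Equiv.Perm (Fin (2 ^ m))),
    InFamily m T S → permInstance m T S ∈ svlPromise m T := fun _ _ _ h => permInstance_mem h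

/-- And its SVL bit is the parity of `x_T`. -/
theorem svlSinkBit_permInstance {S : Equiv.Perm (Fin (2 ^ m))} (hS : InFamily m T S) :
    svlSinkBit m T (permInstance m T S) = sinkOdd m T S :=
  (isSvlLine_permInstance hS).svlSinkBit_eq

/-- Reading the S-table of a permutation instance. -/
@[simp] theorem svlSucc_permInstance (S : Equiv.Perm (Fin (2 ^ m))) (x : Fin (2 ^ m)) :
    svlSucc (permInstance m T S) x = S x :=
  svlSucc_svlInput _ _ _

/-- Reading a bit of the S-table of a permutation instance. -/
@[simp] theorem svlSuccBit_permInstance (S : Equiv.Perm (Fin (2 ^ m))) (x : Fin (2 ^ m))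
    (j : Fin m) : svlSuccBit (permInstance m T S) x j = (S x).val.testBit j.val :=
  svlSuccBit_svlInput _ _ _ _

/-- Reading the V-table of a permutation instance. -/
@[simp] theorem svlVerify_permInstance (S : Equiv.Perm (Fin (2 ^ m))) (x : Fin (2 ^ m))
    (i : Fin (T + 1)) : svlVerify (permInstance m T S) x i = decide (x = lineOf m T S i) :=
  svlVerify_svlInput _ _ _ _

/-- The instance determines the permutation (its S-table IS the permutation). -/
theorem permInstance_injective : Function.Injective (permInstance m T) := by
  intro S₁ S₂ h
  ext x
  have h' := congrArg (fun t => svlSucc t x) h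
  simp only [svlSucc_permInstance] at h'
  rw [h']

/-- Unpacking membership in `famX`. -/
theorem mem_famX {t : SVLInput m T} :
    t ∈ famX m T ↔ ∃ S : Equiv.Perm (Fin (2 ^ m)),
      (InFamily m T S ∧ sinkOdd m T S = false) ∧ permInstance m T S = t := by
  unfold famX
  simp only [Finset.mem_image, Finset.mem_filter, Finset.mem_univ, true_and]

/-- Unpacking membership in `famY`. -/
theorem mem_famY {t : SVLInput m T} :
    t ∈ famY m T ↔ ∃ S : Equiv.Perm (Fin (2 ^ m)),
      (InFamily m T S ∧ sinkOdd m T S = true) ∧ permInstance m T S = t := by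
  unfold famY
  simp only [Finset.mem_image, Finset.mem_filter, Finset.mem_univ, true_and]

/-- Unpacking membership in `rel`. -/
theorem mem_rel {p : SVLInput m T × SVLInput m T} :
    p ∈ rel m T ↔ ∃ S S' : Equiv.Perm (Fin (2 ^ m)), IsSurgery m T S S' ∧
      sinkOdd m T S = false ∧ sinkOdd m T S' = true ∧
        p = (permInstance m T S, permInstance m T S') := by
  unfold rel
  simp only [Finset.mem_image, Finset.mem_filter, Finset.mem_univ, true_and, Prod.exists]
  exact ⟨fun ⟨S, S', ⟨h1, h2, h3⟩, h4⟩ => ⟨S, S', h1, h2, h3, h4.symm⟩,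
    fun ⟨S, S', h1, h2, h3, h4⟩ => ⟨S, S', ⟨h1, h2, h3⟩, h4.symm⟩⟩

/-- Membership in `rel` for a pair of permutation instances. -/
theorem mk_mem_rel_iff {S S' : Equiv.Perm (Fin (2 ^ m))} :
    (permInstance m T S, permInstance m T S') ∈ rel m T ↔
      IsSurgery m T S S' ∧ sinkOdd m T S = false ∧ sinkOdd m T S' = true := by
  rw [mem_rel]
  constructor
  · rintro ⟨S₁, S₁', h1, h2, h3, h4⟩
    obtain ⟨e1, e2⟩ := Prod.mk.inj h4
    cases permInstance_injective e1
    cases permInstance_injective e2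
    exact ⟨h1, h2, h3⟩
  · rintro ⟨h1, h2, h3⟩
    exact ⟨S, S', h1, h2, h3, rfl⟩

/-- **Well-formedness.** Every pair of `rel` joins an `X`-instance to a `Y`-instance, both in
the promise set, with sink bits `false` / `true`. -/
theorem rel_wellFormed (m T : ℕ) : ∀ p ∈ rel m T,
    p.1 ∈ famX m T ∧ p.2 ∈ famY m T ∧ p.1 ∈ svlPromise m T ∧ p.2 ∈ svlPromise m T ∧
      svlSinkBit m T p.1 = false ∧ svlSinkBit m T p.2 = true := by
  intro p hp
  obtain ⟨S, S', hSS', h0, h1, rfl⟩ := mem_rel.1 hp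
  have hS : InFamily m T S := hSS'.1
  have hS' : InFamily m T S' := hSS'.2.1
  refine ⟨?_, ?_, permInstance_mem hS, permInstance_mem hS', ?_, ?_⟩
  · exact mem_famX.2 ⟨S, ⟨hS, h0⟩, rfl⟩
  · exact mem_famY.2 ⟨S', ⟨hS', h1⟩, rfl⟩
  · show svlSinkBit m T (permInstance m T S) = false
    rw [svlSinkBit_permInstance hS, h0]
  · show svlSinkBit m T (permInstance m T S') = true
    rw [svlSinkBit_permInstance hS', h1]

end Family

/-- `L* = max (N², 4 · hid² · N)`, `N = 2^m`: the per-pair per-bit product bound of the line. -/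
def Lstar (m T : ℕ) : ℝ := max ((2 : ℝ) ^ m * 2 ^ m) (4 * (hid m T : ℝ) ^ 2 * 2 ^ m)

/-- `d* = hid · N / 8`: the min-degree bound of the line. -/
def dstar (m T : ℕ) : ℝ := (hid m T : ℝ) * 2 ^ m / 8

/-! ## §3 Counting vocabulary for the degree bound -/

section Counting

variable {m T : ℕ}

/-- `v` is off the `S`-orbit of the source (on another cycle of `S`). -/
def OffCycle (S : Equiv.Perm (Fin (2 ^ m))) (v : Fin (2 ^ m)) : Prop := ∀ j : ℕ, pt S j ≠ v

/-- The length of the `S`-orbit of the source (its minimal period). -/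
def srcPeriod (S : Equiv.Perm (Fin (2 ^ m))) : ℕ := Function.minimalPeriod S (src m)

/-- Every point of a permutation of a finite type is periodic. -/
theorem mem_periodicPts (S : Equiv.Perm (Fin (2 ^ m))) (x : Fin (2 ^ m)) :
    x ∈ Function.periodicPts S := by
  rw [(Function.injective_iff_periodicPts_eq_univ (f := (S : Fin (2 ^ m) → Fin (2 ^ m)))).1
    S.injective]
  trivial

/-- The source period is positive. -/
theorem srcPeriod_pos (S : Equiv.Perm (Fin (2 ^ m))) : 0 < srcPeriod S :=
  Function.minimalPeriod_pos_of_mem_periodicPts (mem_periodicPts S _)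

/-- `pt` as an iterate. -/
theorem pt_eq_iterate (S : Equiv.Perm (Fin (2 ^ m))) (i : ℕ) : pt S i = (S : _ → _)^[i] (src m) := by
  rw [pt, Equiv.Perm.iterate_eq_pow]

/-- The orbit of the source closes up after `srcPeriod S` steps. -/
theorem pt_srcPeriod (S : Equiv.Perm (Fin (2 ^ m))) : pt S (srcPeriod S) = src m := by
  rw [pt_eq_iterate]
  exact Function.iterate_minimalPeriod

/-- The orbit of the source is periodic with period `srcPeriod S`. -/
theorem pt_add_srcPeriod (S : Equiv.Perm (Fin (2 ^ m))) (i : ℕ) :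
    pt S (i + srcPeriod S) = pt S i := by
  rw [add_comm, pt_add, pt_srcPeriod, ← pt]

/-- The orbit reduces modulo the period. -/
theorem pt_mod_srcPeriod (S : Equiv.Perm (Fin (2 ^ m))) (i : ℕ) :
    pt S (i % srcPeriod S) = pt S i := by
  rw [pt_eq_iterate, pt_eq_iterate]
  exact Function.iterate_mod_minimalPeriod_eq

/-- Below the period the orbit points are pairwise distinct. -/
theorem pt_injOn_lt_srcPeriod (S : Equiv.Perm (Fin (2 ^ m))) {i j : ℕ} (hi : i < srcPeriod S)
    (hj : j < srcPeriod S) (h : pt S i = pt S j) : i = j := by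
  rw [pt_eq_iterate, pt_eq_iterate] at h
  exact Function.iterate_injOn_Iio_minimalPeriod hi hj h

/-- A point of the orbit of the source is `pt S i` for some `i < srcPeriod S`. -/
theorem exists_lt_srcPeriod_of_not_offCycle {S : Equiv.Perm (Fin (2 ^ m))} {v : Fin (2 ^ m)}
    (h : ¬ OffCycle S v) : ∃ i : ℕ, i < srcPeriod S ∧ pt S i = v := by
  unfold OffCycle at h
  push Not at h
  obtain ⟨j, hj⟩ := h
  exact ⟨j % srcPeriod S, Nat.mod_lt _ (srcPeriod_pos S), by rw [pt_mod_srcPeriod, hj]⟩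

/-- A simple line `x_0, …, x_T` forces the source period to exceed `T`. -/
theorem lt_srcPeriod_of_injective {S : Equiv.Perm (Fin (2 ^ m))}
    (hinj : Function.Injective (lineOf m T S)) : T < srcPeriod S := by
  by_contra h
  push Not at h
  have h0 := pt_injOn_of_injective hinj h (Nat.zero_le T) (by rw [pt_srcPeriod, pt_zero])
  exact (srcPeriod_pos S).ne' h0

open scoped Classical in
/-- Merge vertices at cut `k` with new-sink parity `b`: names `v` off the source cycle whose
image `S^(T-k) v` (the sink of `S * swap(x_k, v)`) has parity `b`. -/
def mergeGood (m T : ℕ) (S : Equiv.Perm (Fin (2 ^ m))) (k : ℕ) (b : Bool) : Finset (Fin (2 ^ m)) :=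
  Finset.univ.filter fun v => OffCycle S v ∧ decide (((S ^ (T - k)) v).val % 2 = 1) = b

/-- Far-split positions at cut `k` with new-sink parity `b`: indices `q` on the source cycle with
`k + hid < q` (the excised cycle `x_{k+1} … x_q` is longer than `hid`) and `q + (T - k) < srcPeriod`
(the sink `x_{q+T-k}` of `S * swap(x_k, x_q)` is reached before the cycle closes), of parity `b`. -/
def splitGood (m T : ℕ) (S : Equiv.Perm (Fin (2 ^ m))) (k : ℕ) (b : Bool) : Finset ℕ :=
  (Finset.range (srcPeriod S)).filter fun q =>
    k + hid m T < q ∧ q + (T - k) < srcPeriod S ∧ decide ((pt S (q + (T - k))).val % 2 = 1) = b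

/-- Unpacking membership in `mergeGood`. -/
theorem mem_mergeGood {S : Equiv.Perm (Fin (2 ^ m))} {k : ℕ} {b : Bool} {v : Fin (2 ^ m)} :
    v ∈ mergeGood m T S k b ↔ OffCycle S v ∧ decide (((S ^ (T - k)) v).val % 2 = 1) = b := by
  classical
  unfold mergeGood
  simp only [Finset.mem_filter, Finset.mem_univ, true_and]

/-- Unpacking membership in `splitGood`. -/
theorem mem_splitGood {S : Equiv.Perm (Fin (2 ^ m))} {k : ℕ} {b : Bool} {q : ℕ} :
    q ∈ splitGood m T S k b ↔ k + hid m T < q ∧ q + (T - k) < srcPeriod S ∧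
      decide ((pt S (q + (T - k))).val % 2 = 1) = b := by
  unfold splitGood
  simp only [Finset.mem_filter, Finset.mem_range]
  constructor
  · rintro ⟨-, h⟩; exact h
  · rintro h; exact ⟨by omega, h⟩

end Counting

end Summit.QuantumAdvantage.QuantumAdvantage.Theorems.WbwVerifiableLineNoSpeedup.CycleSurgery

end
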